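import Summits.BirchSwinnertonDyer.Rank1Residual.Additive.ChiBranchLowerInput
import Summits.BirchSwinnertonDyer.Rank1Residual.Additive.GordCharLeadingTerm
import Summits.BirchSwinnertonDyer.Rank1Residual.Additive.RamifiedTwistMinimality
import Summits.BirchSwinnertonDyer.Rank1Residual.Additive.MinusPeriodRatio
import Summits.BirchSwinnertonDyer.Rank1Residual.Additive.GordBranchMeetsField
import Summits.BirchSwinnertonDyer.Rank1Residual.Additive.GordChiBranchKatoComponent
import HarnessLib

/-!
# The LOWER half at an additive prime: TRANSPORT between the `χ_p`-branch form and the cyclotomic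
# form at `T = 0` (cell `b2b-bsdres`, team n1011, seat p07, row T-N10-low; sequel of `ChiBranchLowerInput.lean`)

HONEST FRAMING (cell `b2b-bsdres`, run/shared/lean/b2b/bsd-rank1-residual/, verbatim in every
file): the goal of the cell is to DELETE the COMBINATION-SHAPED residual classes of the
Birch–Swinnerton-Dyer formula for ALL analytic-rank `≤ 1` elliptic curves over `ℚ` — "full BSD
formula for every rank `≤ 1` curve in class `C`" assembled STRICTLY from published theorems — so
that the rank-`≤ 1` remainder becomes exactly the CONSTRUCTION-SHAPED classes, which are TYPED
(missing-input `Prop`s), NOT attempted. This is not "finishing BSD". Team n1011 (RESIDUAL-MAP §I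
N10 / N11): prove what is provable now; shrink each hard class to its core with data; no claim
beyond stated classes. Research route on the CONSTRUCTION-SHAPED item N10; N10 stays CONSTRUCTION;
nothing is booked; no label moves. Theorems only (no definition, no new named fact).

## What this file proves (CLASS-CLOSURE-PLAN §3.2 deliverable "twist-transport lemma", LOWER half)

The team's ONE typed cyclotomic lower input at `T = 0` is additive-p2's
`CycLowerLeadingTermAt W p` (`GordCharLeadingTerm.lean`: for every generator `f` of
`char_Λ X(E/ℚ_∞)`, `L(E,1)/Ω_E` divides `f(0)` in `ℤ_p` — the Skinner–Urban / Eisenstein-congruence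
direction of Delbourgo's Main Conjecture (G)/(M) at the trivial character). Its `χ_p`-BRANCH forms
are the typed inputs of `ChiBranchLowerInput.lean` (this seat): `ChiBranchLowerLeadingTermAt W p`
(`p ≡ 1 (mod 4)`) / `ChiBranchLowerLeadingTermOddAt W p` (`p ≡ 3 (mod 4)`): for every semistable-twist
datum `(V = E♭, C, f♭, ϖ, κ, γ, D)` EVERY `g ∈ char_Λ X(W/ℚ_∞)` has
`g(0) ∈ (ϖ · ∑_{a mod p}(a/p)[a/p]^±_{f♭}) · ℤ_p` — the statement an Iwasawa-theoretic source on the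
`ω^{(p−1)/2}`-component of `E♭` would deliver (Skinner–Urban 2014 Thm. 3.6.4 gives this direction on
the `ω^0`-component only; Burungale–Skinner–Tian–Wan arXiv:2409.01350 announce it for `g ⊗ χ_K`,
`p ∣ d_K`, `p ∤ 6N_g`). Here:

* §1 `cycLowerLeadingTermAt_of_chiBranchLower` (`p ≡ 1 (mod 4)`, binder `hPal` = Pal 2012 Thm. 3.2)
  and `cycLowerLeadingTermAt_of_chiBranchLowerOdd` (`p ≡ 3 (mod 4)`, Pal PROVED for `d < 0`): given ONE
  semistable-twist datum, **branch form ⟹ cyclotomic form**, by Birch's formula and Pal's period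
  theorem in the tree's shape `L(E,1) = ±ϖ·(∑…)·Ω_E` (`entireLFunction_one_eq_of_twist[_neg]`; the odd
  correction `|u(C)|·c_∞(E)` is a `p`-adic unit, `padicValRat_u_eq_zero_of_twist_pm_p`);
* §2 `chiBranchLowerLeadingTermAt_of_cycLower[_odd]`: **cyclotomic form ⟹ branch form** (same
  identity read backwards; `char_Λ X` is principal, `charIdeal_isPrincipal_holds`), hence the two
  currencies are EQUIVALENT wherever a datum exists (§3);
* §3 class forms supplying the datum on the (G)-ordinary defect-2 rows
  (`TypeGOrd.exists_goodOrd_model_twist_pStar`, additive-p2; newform and period ratios from a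
  parametrisation datum `hmodD`):
  `cycLowerLeadingTermAt_iff_chiBranchLower[Odd]_of_typeGOrd_of_semistabilityIndex_eq_two`; the
  X4(M) / X3♯(M) forms (`ClassX4M/ClassX3M.exists_mult_pStar_twist_model`, additive-p1) are in the
  sequel `ChiBranchLowerTransportPotMult.lean`.

Downstream (Miller currency `Typed.MissingLowerBoundAt`): through the exact Delbourgo 1998 Prop. 4 on
the (M) locus (`Delbourgo1998.prop4_rankZero_constantCoeff_eq_unit_mul_of_potMult`, n1011-p18) resp.
Delbourgo 2002 on the (G)-cell (`GordCharLeadingTermConsequences.lean`, additive-p2) — composed in the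
team's consumer files, not here. HONEST NOTE (CLASS-CLOSURE-PLAN §3.1 E3): `L(E,1)` and `L(E♭,1)` are
values of `E♭`'s measure at DIFFERENT characters; nothing here transports a statement about `E♭` on
the `ω^0`-component to `E`; no lower-bound theorem is in print at any additive pair (RESIDUAL-MAP §I
N10). Labels UNCHANGED.

References: Pal 2012 [Pal2012] Thm. 3.2; Mazur–Tate–Teitelbaum 1986 [MazurTateTeitelbaum1986Invent]
§I.8 (Birch), §I.14; Delbourgo 1998 [Delbourgo1998] Main Conjecture p. 151; Skinner–Urban 2014
[SkinnerUrban2014] Thm. 3.6.4, Remarks (i) p. 43; Edixhoven 1991 [EdixhovenManin1991] §1.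
-/

noncomputable section

open scoped Classical MatrixGroups ModularForm NumberField

open CongruenceSubgroup WeierstrassCurve NumberField Literature.NumberTheory.EllipticCurves
  Literature.NumberTheory.EllipticCurves.ModularForms
  Literature.NumberTheory.EllipticCurves.Rank1Residual
  IsDedekindDomain Rat.HeightOneSpectrum

namespace Summit.BirchSwinnertonDyer.Rank1Residual.Additive

variable (W : WeierstrassCurve ℚ) [W.IsElliptic] [W.IsGloballyMinimal] (p : ℕ) [hp : Fact p.Prime]

/-! ### §1 Branch form ⟹ cyclotomic form, given one semistable-twist datum -/

/-- **`p ≡ 1 (mod 4)`: `ChiBranchLowerLeadingTermAt W p ⟹ CycLowerLeadingTermAt W p` given a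
semistable-twist datum.** For `E = W` additive at `p`, `ℚ`-isomorphic to the twist by `p` of a
globally minimal `V = E♭` good ordinary or multiplicative at `p`, `f` the newform of `V`,
`ϖ·Ω_V = Ω⁺_f`: if every `g ∈ char_Λ X(E/ℚ_∞)` has `g(0) = h·ϖ·∑(a/p)[a/p]⁺_f` (`h ∈ ℤ_p`), then every
generator has `f(0) = c·L(E,1)/Ω_E` with `c = ±h ∈ ℤ_p`, by `L(E,1) = ±ϖ·(∑…)·Ω_E` (Birch + Pal
2012 Thm. 3.2, named fact `hPal`). [cite: Pal2012, Thm. 3.2] [cite: MazurTateTeitelbaum1986Invent, §I.8 (8.6)] -/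
theorem cycLowerLeadingTermAt_of_chiBranchLower
    (hPal : Pal2012.thm32_sqrt_mul_realPeriodRat_twist_eq_of_prime_one_mod_four)
    (hmod : hasEntireLFunction_rat) (hp4 : p % 4 = 1) (hadd : Addv W p)
    (V : WeierstrassCurve ℚ) [V.IsElliptic] [V.IsGloballyMinimal]
    (hVW : ∃ C : VariableChange ℚ, C • V.quadraticTwist (p : ℚ) = W) (hV : GoodOrd V p ∨ Mult V p)
    {N : ℕ} [NeZero N] {f : CuspForm (Gamma0 N) 2} (hf : IsNewformOf V f)
    (ϖ : ℚ) (hϖ : (ϖ : ℝ) * V.realPeriodRat = plusPeriod f)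
    (hLow : ChiBranchLowerLeadingTermAt W p) : CycLowerLeadingTermAt W p := by
  intro κ γ hκ hγ hγ' D f₀ hf₀
  obtain ⟨ε, hε, hLq⟩ :=
    entireLFunction_one_eq_of_twist p hPal hmod hp4 V W hVW (hV.imp_left fun h ↦ h.1) hadd hf ϖ hϖ
  have hmem : f₀ ∈ D.charIdeal := by
    change f₀ ∈ Module.charIdeal (IwasawaAlgebra p) D.X
    rw [show Module.charIdeal (IwasawaAlgebra p) D.X = Ideal.span {f₀} from hf₀]
    exact Ideal.mem_span_singleton_self f₀
  obtain ⟨h, hg0⟩ := hLow V hp4 hVW hV hκ hγ hγ' hf D ϖ hϖ f₀ hmem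
  have hε0 : ε ≠ 0 := by rcases hε with rfl | rfl <;> norm_num
  have hεv : padicValRat p ε = 0 := by
    rcases hε with rfl | rfl
    · exact padicValRat.one
    · rw [padicValRat.neg]; exact padicValRat.one
  obtain ⟨w, hw⟩ := exists_units_coe_eq_ratCast p hε0 hεv
  have hε2 : ((ε : ℚ) : ℚ_[p]) ^ 2 = 1 := by rcases hε with rfl | rfl <;> norm_num
  refine ⟨ε * (ϖ * legendrePlusSymbolSum f p), hLq, h * (w : ℤ_[p]), ?_⟩
  rw [hg0, PadicInt.coe_mul, hw]
  push_cast
  linear_combination (-((h : ℚ_[p]) * (ϖ : ℚ_[p]) * (legendrePlusSymbolSum f p : ℚ_[p]))) * hε2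

/-- **`p ≡ 3 (mod 4)` (`p = 3` included): `ChiBranchLowerLeadingTermOddAt W p ⟹ CycLowerLeadingTermAt W p`
given a semistable-twist datum** `W = C • V^{(−p)}`, `V = E♭` globally minimal, good ordinary or
multiplicative at `p`, `f` its newform, `ϖ⁻·|Ω⁻(V)| = Ω⁻_f`. The tree's odd Birch + Pal identity
`L(E,1) = ±ϖ⁻·(∑(a/p)[a/p]⁻_f)·Ω_E/(|u(C)|·c_∞(E))` (Pal 2012 Thm. 3.2 for `d < 0`, PROVED; no named
fact besides modularity) has the correction `|u(C)|·c_∞(E)`, a `p`-adic unit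
(`padicValRat_u_eq_zero_of_twist_pm_p`: the twisted model is `p`-minimal; `c_∞ ∈ {1,2}`), so
`f(0) = c·L(E,1)/Ω_E` with `c = ±h·|u(C)|·c_∞ ∈ ℤ_p`. [cite: Pal2012, Thm. 3.2]
[cite: MazurTateTeitelbaum1986Invent, §I.8 (8.6)] -/
theorem cycLowerLeadingTermAt_of_chiBranchLowerOdd (hmod : hasEntireLFunction_rat) (hp4 : p % 4 = 3)
    (hadd : Addv W p) (V : WeierstrassCurve ℚ) [V.IsElliptic] [V.IsGloballyMinimal]
    (C : VariableChange ℚ) (hC : C • V.quadraticTwist (-(p : ℚ)) = W) (hV : GoodOrd V p ∨ Mult V p)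
    {N : ℕ} [NeZero N] {f : CuspForm (Gamma0 N) 2} (hf : IsNewformOf V f)
    (ϖ : ℚ) (hϖ : (ϖ : ℝ) * V.imaginaryPeriodRat = minusPeriod f)
    (hLow : ChiBranchLowerLeadingTermOddAt W p) : CycLowerLeadingTermAt W p := by
  have hp2 : p ≠ 2 := by omega
  -- `ord_p u(C) = 0`: the twisted model `V^{(−p)}` is already `p`-minimal
  have hC' : C • V.quadraticTwist (((-(p : ℤ)) : ℤ) : ℚ) = W := by push_cast; exact hC
  have hu : padicValRat p (C.u : ℚ) = 0 :=
    padicValRat_u_eq_zero_of_twist_pm_p p hp2 V W (hV.elim (fun h ↦ Or.inl h.1) Or.inr)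
      (Or.inr rfl) C hC'
  intro κ γ hκ hγ hγ' D f₀ hf₀
  obtain ⟨ε, hε, hLq⟩ := entireLFunction_one_eq_of_twist_neg p hmod hp4 V W C hC hadd hf ϖ hϖ
  have hmem : f₀ ∈ D.charIdeal := by
    change f₀ ∈ Module.charIdeal (IwasawaAlgebra p) D.X
    rw [show Module.charIdeal (IwasawaAlgebra p) D.X = Ideal.span {f₀} from hf₀]
    exact Ideal.mem_span_singleton_self f₀
  obtain ⟨h, hg0⟩ := hLow V hp4 ⟨C, hC⟩ hV hκ hγ hγ' hf D ϖ hϖ f₀ hmem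
  set S : ℚ := legendreMinusSymbolSum f p with hS
  set cinf : ℕ := (W.baseChange ℝ).numRealComponents with hcinf
  -- the correcting factor `ε · |u(C)| · c_∞` is a `p`-adic unit
  have hε0 : ε ≠ 0 := by rcases hε with rfl | rfl <;> norm_num
  have hεv : padicValRat p ε = 0 := by
    rcases hε with rfl | rfl
    · exact padicValRat.one
    · rw [padicValRat.neg]; exact padicValRat.one
  have hua0 : |(C.u : ℚ)| ≠ 0 := abs_ne_zero.mpr C.u.ne_zero
  have hcinf0 : (cinf : ℚ) ≠ 0 := by
    rw [hcinf, numRealComponents]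
    split_ifs <;> norm_num
  have hvua : padicValRat p |(C.u : ℚ)| = 0 := by
    rcases abs_choice (C.u : ℚ) with h' | h'
    · rw [h']; exact hu
    · rw [h', padicValRat.neg]; exact hu
  have hd0 : ε * (|(C.u : ℚ)| * (cinf : ℚ)) ≠ 0 := mul_ne_zero hε0 (mul_ne_zero hua0 hcinf0)
  have hdv : padicValRat p (ε * (|(C.u : ℚ)| * (cinf : ℚ))) = 0 := by
    rw [padicValRat.mul hε0 (mul_ne_zero hua0 hcinf0), padicValRat.mul hua0 hcinf0, hεv, hvua,
      hcinf, padicValRat_numRealComponents_eq_zero W p hp2]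
    norm_num
  obtain ⟨w, hw⟩ := exists_units_coe_eq_ratCast p hd0 hdv
  -- `ϖ⁻ S⁻ = (ε |u(C)| c_∞) · (ε ϖ⁻ S⁻ / (|u(C)| c_∞))` in `ℚ` (`ε² = 1`)
  have key : ϖ * S =
      (ε * (|(C.u : ℚ)| * (cinf : ℚ))) * (ε * (ϖ * S) / (|(C.u : ℚ)| * (cinf : ℚ))) := by
    have hε2Q : ε ^ 2 = 1 := by rcases hε with rfl | rfl <;> norm_num
    have hdinv : (|(C.u : ℚ)| * (cinf : ℚ)) * (|(C.u : ℚ)| * (cinf : ℚ))⁻¹ = 1 :=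
      mul_inv_cancel₀ (mul_ne_zero hua0 hcinf0)
    rw [div_eq_mul_inv]
    linear_combination (-(ϖ * S)) * hε2Q + (-(ϖ * S * ε ^ 2)) * hdinv
  refine ⟨_, hLq, h * (w : ℤ_[p]), ?_⟩
  rw [hg0, PadicInt.coe_mul, hw, mul_assoc (h : ℚ_[p]), mul_assoc (h : ℚ_[p]), ← Rat.cast_mul,
    ← Rat.cast_mul, ← key]

/-! ### §2 Cyclotomic form ⟹ branch form (the identity read backwards) -/

/-- **`p ≡ 1 (mod 4)`: `CycLowerLeadingTermAt W p ⟹ ChiBranchLowerLeadingTermAt W p`** for `W`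
additive at `p`. For any semistable-twist datum and any `g ∈ char_Λ X(W/ℚ_∞) = (f₀)`: `g = k·f₀`,
`f₀(0) = c·q`, `q = L(E,1)/Ω_E = ±ϖ·∑(a/p)[a/p]⁺_f` (Birch + Pal, `hPal`; `Ω_E ≠ 0`), so
`g(0) = (k(0)·c·(±1))·ϖ·∑…`. [cite: Pal2012, Thm. 3.2] [cite: MazurTateTeitelbaum1986Invent, §I.8 (8.6)] -/
theorem chiBranchLowerLeadingTermAt_of_cycLower
    (hPal : Pal2012.thm32_sqrt_mul_realPeriodRat_twist_eq_of_prime_one_mod_four)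
    (hmod : hasEntireLFunction_rat) (hadd : Addv W p) (hLow : CycLowerLeadingTermAt W p) :
    ChiBranchLowerLeadingTermAt W p := by
  intro V _ _ κ γ N _ f hp4 hVW hV hκ hγ hγ' hf D ϖ hϖ g hgmem
  -- a generator of the (principal) characteristic ideal
  haveI : (Module.charIdeal (IwasawaAlgebra p) D.X).IsPrincipal := charIdeal_isPrincipal_holds p D.X
  obtain ⟨f₀, hf₀⟩ := Submodule.IsPrincipal.principal (Module.charIdeal (IwasawaAlgebra p) D.X)
  obtain ⟨q, hLq, c, hc⟩ := hLow κ γ hκ hγ hγ' D f₀ hf₀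
  -- `g = k · f₀`
  have hgspan : g ∈ Ideal.span {f₀} := by
    change g ∈ Module.charIdeal (IwasawaAlgebra p) D.X at hgmem
    rwa [hf₀] at hgmem
  obtain ⟨k, hk⟩ := Ideal.mem_span_singleton'.mp hgspan
  -- `q = ε · ϖ · ∑` by Birch + Pal
  obtain ⟨ε, hε, hLq'⟩ :=
    entireLFunction_one_eq_of_twist p hPal hmod hp4 V W hVW (hV.imp_left fun h ↦ h.1) hadd hf ϖ hϖ
  have hΩ : (W.realPeriodRat : ℂ) ≠ 0 := by exact_mod_cast W.realPeriodRat_pos_holds.ne'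
  have hq : q = ε * (ϖ * legendrePlusSymbolSum f p) := by
    have h1 := hLq.symm.trans hLq'
    exact_mod_cast mul_right_cancel₀ hΩ h1
  have hε0 : ε ≠ 0 := by rcases hε with rfl | rfl <;> norm_num
  have hεv : padicValRat p ε = 0 := by
    rcases hε with rfl | rfl
    · exact padicValRat.one
    · rw [padicValRat.neg]; exact padicValRat.one
  obtain ⟨w, hw⟩ := exists_units_coe_eq_ratCast p hε0 hεv
  refine ⟨PowerSeries.constantCoeff k * c * (w : ℤ_[p]), ?_⟩
  have hg0 : ((PowerSeries.constantCoeff g : ℤ_[p]) : ℚ_[p]) =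
      ((PowerSeries.constantCoeff k : ℤ_[p]) : ℚ_[p]) * ((c : ℚ_[p]) * (q : ℚ_[p])) := by
    rw [← hk, map_mul, PadicInt.coe_mul, hc]
  rw [hg0, hq, PadicInt.coe_mul, PadicInt.coe_mul, hw]
  push_cast
  ring

/-- **`p ≡ 3 (mod 4)`: `CycLowerLeadingTermAt W p ⟹ ChiBranchLowerLeadingTermOddAt W p`** for `W`
additive at `p` (odd Birch + Pal, PROVED; the correction `ε·|u(C)|·c_∞(E)` is a `p`-adic unit).
[cite: Pal2012, Thm. 3.2] [cite: MazurTateTeitelbaum1986Invent, §I.8 (8.6)] -/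
theorem chiBranchLowerLeadingTermOddAt_of_cycLower (hmod : hasEntireLFunction_rat) (hadd : Addv W p)
    (hLow : CycLowerLeadingTermAt W p) : ChiBranchLowerLeadingTermOddAt W p := by
  intro V _ _ κ γ N _ f hp4 hVW hV hκ hγ hγ' hf D ϖ hϖ g hgmem
  have hp2 : p ≠ 2 := by omega
  obtain ⟨C, hC⟩ := hVW
  have hC' : C • V.quadraticTwist (((-(p : ℤ)) : ℤ) : ℚ) = W := by push_cast; exact hC
  have hu : padicValRat p (C.u : ℚ) = 0 :=
    padicValRat_u_eq_zero_of_twist_pm_p p hp2 V W (hV.elim (fun h ↦ Or.inl h.1) Or.inr)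
      (Or.inr rfl) C hC'
  haveI : (Module.charIdeal (IwasawaAlgebra p) D.X).IsPrincipal := charIdeal_isPrincipal_holds p D.X
  obtain ⟨f₀, hf₀⟩ := Submodule.IsPrincipal.principal (Module.charIdeal (IwasawaAlgebra p) D.X)
  obtain ⟨q, hLq, c, hc⟩ := hLow κ γ hκ hγ hγ' D f₀ hf₀
  have hgspan : g ∈ Ideal.span {f₀} := by
    change g ∈ Module.charIdeal (IwasawaAlgebra p) D.X at hgmem
    rwa [hf₀] at hgmem
  obtain ⟨k, hk⟩ := Ideal.mem_span_singleton'.mp hgspan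
  obtain ⟨ε, hε, hLq'⟩ := entireLFunction_one_eq_of_twist_neg p hmod hp4 V W C hC hadd hf ϖ hϖ
  set S : ℚ := legendreMinusSymbolSum f p with hS
  set cinf : ℕ := (W.baseChange ℝ).numRealComponents with hcinf
  have hΩ : (W.realPeriodRat : ℂ) ≠ 0 := by exact_mod_cast W.realPeriodRat_pos_holds.ne'
  have hq : q = ε * (ϖ * S) / (|(C.u : ℚ)| * (cinf : ℚ)) := by
    have h1 := hLq.symm.trans hLq'
    exact_mod_cast mul_right_cancel₀ hΩ h1
  have hε0 : ε ≠ 0 := by rcases hε with rfl | rfl <;> norm_num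
  have hεv : padicValRat p ε = 0 := by
    rcases hε with rfl | rfl
    · exact padicValRat.one
    · rw [padicValRat.neg]; exact padicValRat.one
  have hua0 : |(C.u : ℚ)| ≠ 0 := abs_ne_zero.mpr C.u.ne_zero
  have hcinf0 : (cinf : ℚ) ≠ 0 := by
    rw [hcinf, numRealComponents]
    split_ifs <;> norm_num
  have hvua : padicValRat p |(C.u : ℚ)| = 0 := by
    rcases abs_choice (C.u : ℚ) with h' | h'
    · rw [h']; exact hu
    · rw [h', padicValRat.neg]; exact hu
  have hd0 : ε * (|(C.u : ℚ)| * (cinf : ℚ)) ≠ 0 := mul_ne_zero hε0 (mul_ne_zero hua0 hcinf0)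
  have hdv : padicValRat p (ε * (|(C.u : ℚ)| * (cinf : ℚ))) = 0 := by
    rw [padicValRat.mul hε0 (mul_ne_zero hua0 hcinf0), padicValRat.mul hua0 hcinf0, hεv, hvua,
      hcinf, padicValRat_numRealComponents_eq_zero W p hp2]
    norm_num
  obtain ⟨w, hw⟩ := exists_units_coe_eq_ratCast p hd0 hdv
  -- `(ε |u| c_∞) · q = ϖ⁻ S⁻`
  have key : (ε * (|(C.u : ℚ)| * (cinf : ℚ))) * q = ϖ * S := by
    have hε2Q : ε ^ 2 = 1 := by rcases hε with rfl | rfl <;> norm_num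
    rw [hq, mul_div_assoc', div_eq_iff (mul_ne_zero hua0 hcinf0)]
    linear_combination (ϖ * S * (|(C.u : ℚ)| * (cinf : ℚ))) * hε2Q
  refine ⟨PowerSeries.constantCoeff k * c * ((w⁻¹ : ℤ_[p]ˣ) : ℤ_[p]), ?_⟩
  have hg0 : ((PowerSeries.constantCoeff g : ℤ_[p]) : ℚ_[p]) =
      ((PowerSeries.constantCoeff k : ℤ_[p]) : ℚ_[p]) * ((c : ℚ_[p]) * (q : ℚ_[p])) := by
    rw [← hk, map_mul, PadicInt.coe_mul, hc]
  have key' : ((ε * (|(C.u : ℚ)| * (cinf : ℚ)) : ℚ) : ℚ_[p]) * (q : ℚ_[p]) =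
      (ϖ : ℚ_[p]) * (S : ℚ_[p]) := by
    rw [← Rat.cast_mul, key, Rat.cast_mul]
  have e1 : (ϖ : ℚ_[p]) * (S : ℚ_[p]) = ((w : ℤ_[p]) : ℚ_[p]) * (q : ℚ_[p]) := by
    rw [hw]; exact key'.symm
  have hwinv : (((w⁻¹ : ℤ_[p]ˣ) : ℤ_[p]) : ℚ_[p]) * ((w : ℤ_[p]) : ℚ_[p]) = 1 := by
    rw [← PadicInt.coe_mul, Units.inv_mul, PadicInt.coe_one]
  rw [hg0, PadicInt.coe_mul, PadicInt.coe_mul]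
  linear_combination
    (-(((PowerSeries.constantCoeff k : ℤ_[p]) : ℚ_[p]) * (c : ℚ_[p]) *
        (((w⁻¹ : ℤ_[p]ˣ) : ℤ_[p]) : ℚ_[p]))) * e1 +
      (-(((PowerSeries.constantCoeff k : ℤ_[p]) : ℚ_[p]) * (c : ℚ_[p]) * (q : ℚ_[p]))) * hwinv

/-! ### §3 Class forms: the semistable-twist datum supplied, the two currencies EQUIVALENT -/

/-- **(G)-ordinary, defect 2 (`I₀*`), `p ≡ 1 (mod 4)`: the two LOWER currencies are EQUIVALENT** —
`CycLowerLeadingTermAt W p ↔ ChiBranchLowerLeadingTermAt W p` — the datum being the good ordinary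
minimal twist model (`TypeGOrd.exists_goodOrd_model_twist_pStar`, additive-p2) with its newform and
period ratio (`hmodD`). [cite: Pal2012, Thm. 3.2] [cite: EdixhovenManin1991, §1] -/
theorem cycLowerLeadingTermAt_iff_chiBranchLower_of_typeGOrd_of_semistabilityIndex_eq_two
    (hPal : Pal2012.thm32_sqrt_mul_realPeriodRat_twist_eq_of_prime_one_mod_four)
    (hmod : hasEntireLFunction_rat) (hmodD : nonempty_modularParametrizationData)
    (hp4 : p % 4 = 1) (hadd : Addv W p) (hG : TypeGOrd W p) (he : semistabilityIndex W p = 2) :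
    CycLowerLeadingTermAt W p ↔ ChiBranchLowerLeadingTermAt W p := by
  refine ⟨chiBranchLowerLeadingTermAt_of_cycLower W p hPal hmod hadd, fun hLow ↦ ?_⟩
  have hp2 : p ≠ 2 := by omega
  have hp0 : (p : ℚ) ≠ 0 := by exact_mod_cast hp.out.ne_zero
  obtain ⟨V, iV, iVm, hWV, hord⟩ := TypeGOrd.exists_goodOrd_model_twist_pStar W p hp2 hG hadd he
  rw [pStar_eq_self_of_mod_four_eq_one hp4] at hWV
  have hVW : ∃ C : VariableChange ℚ, C • V.quadraticTwist (p : ℚ) = W :=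
    exists_variableChange_quadraticTwist_symm V W hp0 hWV
  haveI : NeZero (V.conductorNorm ℤ) := ⟨(V.conductorNorm_pos_holds).ne'⟩
  obtain ⟨Dm⟩ := hmodD V
  obtain ⟨ϖ, -, hϖ, -⟩ := Dm.exists_rat_mul_realPeriodRat_eq_plusPeriod
  exact cycLowerLeadingTermAt_of_chiBranchLower W p hPal hmod hp4 hadd V hVW (Or.inl hord)
    Dm.isNewformOf ϖ hϖ hLow

/-- **(G)-ordinary, defect 2 (`I₀*`), `p ≡ 3 (mod 4)` (`p = 3` included): the two LOWER currencies
are EQUIVALENT** — `CycLowerLeadingTermAt W p ↔ ChiBranchLowerLeadingTermOddAt W p`.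
[cite: Pal2012, Thm. 3.2] [cite: EdixhovenManin1991, §1] -/
theorem cycLowerLeadingTermAt_iff_chiBranchLowerOdd_of_typeGOrd_of_semistabilityIndex_eq_two
    (hmod : hasEntireLFunction_rat) (hmodD : nonempty_modularParametrizationData)
    (hp4 : p % 4 = 3) (hadd : Addv W p) (hG : TypeGOrd W p) (he : semistabilityIndex W p = 2) :
    CycLowerLeadingTermAt W p ↔ ChiBranchLowerLeadingTermOddAt W p := by
  refine ⟨chiBranchLowerLeadingTermOddAt_of_cycLower W p hmod hadd, fun hLow ↦ ?_⟩
  have hp2 : p ≠ 2 := by omega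
  have hp0 : (-(p : ℚ)) ≠ 0 := neg_ne_zero.mpr (by exact_mod_cast hp.out.ne_zero)
  obtain ⟨V, iV, iVm, hWV, hord⟩ := TypeGOrd.exists_goodOrd_model_twist_pStar W p hp2 hG hadd he
  rw [pStar_eq_neg_of_mod_four_eq_three hp4] at hWV
  obtain ⟨C, hC⟩ := exists_variableChange_quadraticTwist_symm V W hp0 hWV
  haveI : NeZero (V.conductorNorm ℤ) := ⟨(V.conductorNorm_pos_holds).ne'⟩
  obtain ⟨Dm⟩ := hmodD V
  obtain ⟨ϖ, -, hϖ⟩ := exists_rat_mul_imaginaryPeriodRat_eq_minusPeriod Dm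
  exact cycLowerLeadingTermAt_of_chiBranchLowerOdd W p hmod hp4 hadd V C hC (Or.inl hord)
    Dm.isNewformOf ϖ hϖ hLow

end Summit.BirchSwinnertonDyer.Rank1Residual.Additive

end
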